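import Summits.NavierStokesRegularity.NavierStokesRegularity.Theses.AxisymmetricExtremality
import Summits.NavierStokesRegularity.NavierStokesRegularity.Theorems.AxisymmetricLiouvilleBoundedSwirl

/-!
# Strategist census sketch (family `s`, seat s20-g2) — crux `AxisymmetricKatoGlobal`
(stmt-NavierStokesRegularity-15453, route AxisymmetricExtremality)

Typed attempts backing `STRATEGY-CENSUS-s20-g2.md`:

* §Weaker-intermediate: `NoAxisymMinimalDatum` (W0) is the weakest statement the route's
  `closes` can consume in place of the crux (`closes_of_noAxisymMinimalDatum`, same 4-line logic
  as `closes` rev 2) and is implied by the crux (`noAxisymMinimalDatum_of_crux`).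
* §Weaker-intermediate / symmetry enlargement: `AxisymmetricKatoGlobalReflZ` (the `C∞h` stratum:
  equivariance under `z ↦ -z`), implied by the crux (`reflZ_of_crux`); it keeps the swirl and
  contains Hou's symmetric scenario, so it is not easier, and it cannot feed `closes` without a
  new (summit-equivalent) topological crux.
* §Decomposition / §Transfer (KNSS–Liouville sibling): the typed split
  `AxisymmetricLiouvilleBoundedSwirl ∧ TypeIIAncientReduction → crux` (`crux_of_liouvilleSplit`,
  proved by pure logic).  Piece 1 is the tree's open conjecture (AX-L); piece 2 (a blow-up must
  leave a NON-constant bounded ancient axisymmetric profile with bounded swirl) is where the whole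
  Type II difficulty sits: `L^∞`-normalised Type II limits may be constant (`b(s) e_z`), so the
  piece is not known and has no source.
-/

namespace Summit.NavierStokesRegularity.NavierStokesRegularity.Cruxes.AxisymmetricKatoGlobal.StrategistS20g2

open Summit.NavierStokesRegularity.NavierStokesRegularity
open Summit.NavierStokesRegularity.NavierStokesRegularity.Theses.AxisymmetricExtremality
open MeasureTheory

local notation "ℝ³" => EuclideanSpace ℝ (Fin 3)
local notation "ℂ³" => EuclideanSpace ℂ (Fin 3)

/-- The written-out axisymmetry clause of the crux (`IsAxisymmetric u₀` unfolded). -/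
def RotEquivariant (u₀ : ℝ³ → ℝ³) : Prop :=
  ∀ (θ : ℝ) (x : ℝ³), u₀ (WithLp.toLp 2 ![Real.cos θ * x 0 - Real.sin θ * x 1,
      Real.sin θ * x 0 + Real.cos θ * x 1, x 2]) =
    WithLp.toLp 2 ![Real.cos θ * u₀ x 0 - Real.sin θ * u₀ x 1,
      Real.sin θ * u₀ x 0 + Real.cos θ * u₀ x 1, u₀ x 2]

/-- **W0** — no axisymmetric Rusin–Šverák minimal blow-up datum, at any viscosity. This is exactly
what `closes` (rev 2) consumes of the crux. -/
def NoAxisymMinimalDatum : Prop :=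
  ∀ ν : ℝ, 0 < ν → ∀ (u₀ : ℝ³ → ℝ³)
    (g : Literature.Analysis.FunctionSpaces.HomSobolev ℝ³ ℂ³ (1 / 2 : ℝ)),
    Literature.Analysis.FluidPDE.IsMinimalBlowupDatum ν u₀ g → RotEquivariant u₀ → False

/-- W0 can replace the crux in the route's deciding theorem (same logic as `closes`, rev 2). -/
theorem closes_of_noAxisymMinimalDatum (h₂ : MinimalDatumPFold) (h₄ : PFoldToAxisymmetric)
    (h₃ : NoAxisymMinimalDatum) : NavierStokesRegularity := by
  show Literature.NS.NavierStokesExistenceSmoothR3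
  intro ν hν u₀ hsm hdiv hdec
  by_contra hno
  obtain ⟨u₁, g, hmin, hax⟩ := h₄ ν hν (h₂ ν hν ⟨u₀, hsm, hdiv, hdec, hno⟩)
  exact h₃ ν hν u₁ g hmin hax

/-- The crux implies W0 (so W0 is weaker-or-equal; the census argues it is not usefully weaker). -/
theorem noAxisymMinimalDatum_of_crux (h : AxisymmetricKatoGlobal) : NoAxisymMinimalDatum := by
  intro ν hν u₁ g hmin hax
  obtain ⟨hL3, hrep, hdiv₁, -, hnot⟩ := hmin
  exact hnot (h ν hν u₁ g hL3 hrep hdiv₁ hax)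

/-- Equivariance under the reflection `z ↦ -z` (velocity is a polar vector): `u_r, u_θ` even,
`u_z` odd in `z` — the `C∞h` stratum, which KEEPS the swirl. -/
def ReflZEquivariant (u₀ : ℝ³ → ℝ³) : Prop :=
  ∀ x : ℝ³, u₀ (WithLp.toLp 2 ![x 0, x 1, -x 2]) = WithLp.toLp 2 ![u₀ x 0, u₀ x 1, -(u₀ x 2)]

/-- The `C∞h`-symmetric stratum of the crux. -/
def AxisymmetricKatoGlobalReflZ : Prop :=
  ∀ ν : ℝ, 0 < ν → ∀ (u₀ : ℝ³ → ℝ³)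
    (g : Literature.Analysis.FunctionSpaces.HomSobolev ℝ³ ℂ³ (1 / 2 : ℝ)),
    MemLp u₀ 3 volume →
    g.Represents (Literature.Analysis.FunctionSpaces.EuclideanSpace.complexify ∘ u₀) →
    Literature.Analysis.FluidPDE.IsWeaklyDivFree u₀ → RotEquivariant u₀ → ReflZEquivariant u₀ →
    Literature.Analysis.FluidPDE.HasGlobalKatoSolution ν u₀

theorem reflZ_of_crux (h : AxisymmetricKatoGlobal) : AxisymmetricKatoGlobalReflZ :=
  fun ν hν u₀ g hL3 hrep hdiv hax _ => h ν hν u₀ g hL3 hrep hdiv hax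

/-- **Reduction piece of the Liouville split.** A crux datum without a global Kato solution leaves
behind a NON-constant bounded ancient mild solution (`ν = 1`) that is axisymmetric with bounded
swirl. (Not known; the census explains why the `L^∞`-normalised blow-up limit may be constant.) -/
def TypeIIAncientReduction : Prop :=
  ∀ ν : ℝ, 0 < ν → ∀ (u₀ : ℝ³ → ℝ³)
    (g : Literature.Analysis.FunctionSpaces.HomSobolev ℝ³ ℂ³ (1 / 2 : ℝ)),
    MemLp u₀ 3 volume →
    g.Represents (Literature.Analysis.FunctionSpaces.EuclideanSpace.complexify ∘ u₀) →
    Literature.Analysis.FluidPDE.IsWeaklyDivFree u₀ → RotEquivariant u₀ →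
    ¬ Literature.Analysis.FluidPDE.HasGlobalKatoSolution ν u₀ →
      ∃ U : ℝ → ℝ³ → ℝ³, Literature.Analysis.FluidPDE.IsBoundedAncientMildSolution 1 U ∧
        (∀ t < 0, AEStronglyMeasurable (U t) volume) ∧
        (∀ t < 0, Literature.Analysis.FluidPDE.IsAxisymmetric (U t)) ∧
        (∃ C : ℝ, ∀ t < 0, ∀ x, |Literature.Analysis.FluidPDE.swirl (U t) x| ≤ C) ∧
        ¬ (∀ t < 0, ∃ b : ℝ³, U t =ᵐ[volume] fun _ => b)

/-- The Liouville split assembles by pure logic: (AX-L) ∧ reduction ⇒ crux. -/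
theorem crux_of_liouvilleSplit (hL : AxisymmetricLiouvilleBoundedSwirl)
    (hR : TypeIIAncientReduction) : AxisymmetricKatoGlobal := by
  intro ν hν u₀ g hL3 hrep hdiv hax
  by_contra hno
  obtain ⟨U, hU, hmeas, haxU, hsw, hnc⟩ := hR ν hν u₀ g hL3 hrep hdiv hax hno
  exact hnc (hL U hU hmeas haxU hsw)

end Summit.NavierStokesRegularity.NavierStokesRegularity.Cruxes.AxisymmetricKatoGlobal.StrategistS20g2
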